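import Summits.CriticalPhenomena.CardyFormulaZ2.Theorems.CardyMagicRigidityMarkovCascadeDefs
import Summits.CriticalPhenomena.CardyFormulaZ2.Theorems.CardyMagicRigidityNestingRigidityOneGenerationZ2Interiors
import Summits.CriticalPhenomena.CardyFormulaZ2.Theorems.CardyMagicRigidityNestingRigidityOneGenerationZ2Indep
import HarnessLib

/-!
# Stub `stub_oneGenerationZ2`: the one-generation factorisation on `ℤ²`

Crux `Summit.CriticalPhenomena.CardyFormulaZ2.Theses.CardyMagicRigidity.NestingRigidity`
(stmt-CriticalPhenomena-4835), line `markov-cascade-one-generation`, STUB 1 (`OneGenerationZ2`,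
definitions module `Theorems/CardyMagicRigidityMarkovCascadeDefs.lean`): for `δ > 0`, a medial
circuit `γ`, a test density `f` carried by the winding interior of the drawn circuit
`loopCurve δ 0 γ` with `∫ f = 0`, and an event `B = {ω | ω ∩ outsideEdges γ ∈ B₀}` of the edges
strictly outside `γ`,
`E[A_f ; I_γ ∩ B] = M_γ(f) · P(I_γ ∩ B)` under critical bond percolation `P2`, where
`I_γ = {IsInterfaceLoop · γ}`, `A_f = nestingWeight f ∘ bondLoopConfig δ 0` and
`M_γ = condTransformZ2`.

Proof (Camia–Newman CMP 268 §2, the domain-Markov property in transform form).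
1. On `I_γ` every loop `u` of the loop representation that is NOT inside `γ` weighs `1`: the winding
   interiors of two interface loops of one configuration are nested or disjoint
   (`interfaceLoop_interiors_nested_or_disjoint_mesh`), so `int γ ⊆ int u` (phase `∫ f = 0`) or
   `int u ∩ int γ = ∅` (phase `0`); hence `A_f = ∏ᶠ_{inside loops}`
   (`nestingWeight_eq_finprod_inside`).
2. The inside product times `1_{I_γ}` is determined by the restriction of `ω` to the finite set `F`
   of entries of `γ` and of edges at corners with a cell interior to `γ` (cylinder property
   `isInterfaceLoop_iff_of_forall_mem_iff`, locality `exists_eq_cSrc_of_mem`); `F` misses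
   `outsideEdges γ` (`wind_medialPoint_cSrc_ne_zero`).
3. Product structure of `P2` (`bondPercolation_integral_mul_indicator`,
   `bondPercolation_inter_of_determinedBy`): `E[Φ 1_B] = E[Φ] P(B)` and `P(I_γ ∩ B) = P(I_γ) P(B)`;
   divide (or note that both sides vanish when `P(I_γ) = 0` or `γ` is never an interface loop).
-/

noncomputable section

open MeasureTheory Set Filter Function
open scoped Topology BigOperators ENNReal Real

namespace Summit.CriticalPhenomena.CardyFormulaZ2.Cruxes.NestingRigidity.MarkovCascadeOneGeneration

open Literature.Probability.RandomPlanarGeometry Literature.Probability.Percolation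
  Literature.Probability.LatticeModels
open Summit.CriticalPhenomena.CardyFormulaZ2.Theses.CardyMagicRigidity


variable {ω ω' ω₀ : BondConfig (Site 2)} {γ γ' : List MedialVertex} {δ : ℝ} {f : ℂ → ℝ}

/-! ## Step 1: on `I_γ` only the loops inside `γ` weigh -/

/-- A loop of the loop representation is the drawn loop of an interface loop. -/
theorem exists_eq_mk_of_mem_loops {u : UnbasedLoop ℂ} (hu : u ∈ (bondLoopConfig δ 0 ω).loops) :
    ∃ (γ' : List MedialVertex) (h' : IsInterfaceLoop ω γ'),
      u = UnbasedLoop.mk (BasedLoop.mk (loopCurve δ 0 γ') (isLoop_loopCurve δ 0 h'.ne_nil)) := by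
  rcases hu with hu | hu <;> obtain ⟨γ', h', -, rfl⟩ := hu <;> exact ⟨γ', h', rfl⟩

/-- The winding number of the drawn loop of `γ'`, as an unbased loop. -/
theorem wind_mk_loopCurve (h' : IsInterfaceLoop ω γ') (z : ℂ) :
    (UnbasedLoop.mk (BasedLoop.mk (loopCurve δ 0 γ') (isLoop_loopCurve δ 0 h'.ne_nil))).wind z =
      (loopCurve δ 0 γ').wind z := rfl

/-- **A loop of `ω ∈ I_γ` that is not inside `γ` weighs `1`**: its interior contains that of `γ`
(phase `∫ f = 0`) or misses it (phase `0`). -/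
theorem nestingFactor_eq_one_of_not_inside (hδ : 0 < δ) (h : IsInterfaceLoop ω γ)
    (hf : ∀ z, f z ≠ 0 → (loopCurve δ 0 γ).wind z ≠ 0) (hf0 : ∫ z, f z = 0)
    (h' : IsInterfaceLoop ω γ')
    (hnot : ¬ {z | (loopCurve δ 0 γ').wind z ≠ 0} ⊆ {z | (loopCurve δ 0 γ).wind z ≠ 0}) :
    (UnbasedLoop.mk (BasedLoop.mk (loopCurve δ 0 γ') (isLoop_loopCurve δ 0 h'.ne_nil))).nestingFactor
      f = 1 := by
  apply UnbasedLoop.nestingFactor_eq_one_of_nestingPhase_eq_zero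
  rw [UnbasedLoop.nestingPhase]
  simp only [wind_mk_loopCurve h']
  rcases interfaceLoop_interiors_nested_or_disjoint_mesh hδ.ne' h' h with hsub | hsub | hdis
  · exact absurd hsub hnot
  · rw [setIntegral_eq_integral_of_forall_compl_eq_zero fun z hz ↦ ?_, hf0]
    by_contra hfz
    exact hz (hsub (hf z hfz))
  · refine setIntegral_eq_zero_of_forall_eq_zero fun z hz ↦ ?_
    by_contra hfz
    exact disjoint_left.1 hdis hz (hf z hfz)

/-- **Step 1.** On `I_γ` the nesting weight is the product over the loops inside `γ`. -/
theorem nestingWeight_eq_finprod_inside (hδ : 0 < δ) (h : IsInterfaceLoop ω γ)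
    (hf : ∀ z, f z ≠ 0 → (loopCurve δ 0 γ).wind z ≠ 0) (hf0 : ∫ z, f z = 0) :
    (bondLoopConfig δ 0 ω).nestingWeight f = ∏ᶠ u ∈ insideLoopsZ2 δ γ ω, u.nestingFactor f := by
  rw [LoopConfig.nestingWeight]
  refine finprod_mem_inter_mulSupport_eq _ _ _ (Set.ext fun u ↦ ⟨?_, ?_⟩)
  · rintro ⟨hu, hne⟩
    refine ⟨⟨hu, ?_⟩, hne⟩
    by_contra hnot
    obtain ⟨γ', h', rfl⟩ := exists_eq_mk_of_mem_loops hu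
    exact hne (nestingFactor_eq_one_of_not_inside hδ h hf hf0 h'
      (by simpa [wind_mk_loopCurve h'] using hnot))
  · rintro ⟨⟨hu, -⟩, hne⟩
    exact ⟨hu, hne⟩

/-! ## Step 2: the local set of edges `F` and the cylinder structure -/

/-- The coded corners with a cell interior to `γ` form a finite set. -/
theorem finite_setOf_corner_cell (γ : List MedialVertex) :
    {p : Site 2 × Fin 4 | (loopCurve 1 0 γ).wind (meshPoint 1 p.1) ≠ 0 ∨
      (loopCurve 1 0 γ).wind (faceCenter (cFace p)) ≠ 0}.Finite := by
  obtain ⟨ρ, -, hV, hF⟩ := exists_radius_wind_ne_zero γ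
  have hbox : {p : Site 2 × Fin 4 | (loopCurve 1 0 γ).wind (meshPoint 1 p.1) ≠ 0 ∨
      (loopCurve 1 0 γ).wind (faceCenter (cFace p)) ≠ 0} ⊆
      (Set.pi univ fun _ : Fin 2 ↦ Icc (-(⌈ρ⌉ + 1)) (⌈ρ⌉ + 1)) ×ˢ (univ : Set (Fin 4)) := by
    rintro ⟨v, k⟩ hp
    refine ⟨mem_pi_Icc_of_abs_le fun i ↦ ?_, mem_univ _⟩
    have hceil : ρ ≤ ⌈ρ⌉ := Int.le_ceil ρ
    push_cast
    rcases hp with hp | hp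
    · exact ((hV v hp i).trans_le (by linarith)).le
    · have h1 := hF (cFace (v, k)) hp i
      have hc : ((cornerOff k i : ℤ) : ℝ) = 0 ∨ ((cornerOff k i : ℤ) : ℝ) = 1 := by
        fin_cases k <;> fin_cases i <;> simp [cornerOff]
      simp only [cFace, faceAt, Pi.sub_apply, Int.cast_sub] at h1
      rw [abs_lt] at h1
      rw [abs_le]
      constructor <;> rcases hc with hc | hc <;> rw [hc] at h1 <;> linarith [h1.1, h1.2]
  exact ((Set.Finite.pi fun _ ↦ Set.finite_Icc _ _).prod (Set.finite_univ)).subset hbox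

/-- Inclusion of winding interiors descends from mesh `δ` to mesh `1`. -/
theorem setOf_wind_subset_of_mesh (hδ : δ ≠ 0)
    (hsub : {z | (loopCurve δ 0 γ').wind z ≠ 0} ⊆ {z | (loopCurve δ 0 γ).wind z ≠ 0}) :
    {z | (loopCurve 1 0 γ').wind z ≠ 0} ⊆ {z | (loopCurve 1 0 γ).wind z ≠ 0} := by
  rw [setOf_wind_loopCurve_mesh hδ, setOf_wind_loopCurve_mesh hδ] at hsub
  have hsurj : Function.Surjective fun z : ℂ ↦ z / δ := fun w ↦
    ⟨w * δ, mul_div_cancel_right₀ w (Complex.ofReal_ne_zero.2 hδ)⟩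
  exact hsurj.preimage_subset_preimage_iff.1 hsub

/-- The LOCAL EDGES of `γ`: its entries and the edges at corners with a cell interior to `γ`; a
finite set (written inline, no definition). -/
theorem finite_localEdges (γ : List MedialVertex) :
    ({e | e ∈ γ} ∪ cSrc '' {p : Site 2 × Fin 4 | (loopCurve 1 0 γ).wind (meshPoint 1 p.1) ≠ 0 ∨
      (loopCurve 1 0 γ).wind (faceCenter (cFace p)) ≠ 0}).Finite :=
  γ.finite_toSet.union ((finite_setOf_corner_cell γ).image _)

/-- The local edges miss the edges strictly outside `γ` (`γ` an interface loop of some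
configuration). -/
theorem disjoint_localEdges_outsideEdges (h₀ : IsInterfaceLoop ω₀ γ) :
    Disjoint ({e | e ∈ γ} ∪ cSrc '' {p : Site 2 × Fin 4 |
      (loopCurve 1 0 γ).wind (meshPoint 1 p.1) ≠ 0 ∨
        (loopCurve 1 0 γ).wind (faceCenter (cFace p)) ≠ 0}) (outsideEdges γ) := by
  refine disjoint_left.2 fun e he hout ↦ ?_
  rcases he with he | ⟨p, hp, rfl⟩
  · exact hout.2 he
  · exact wind_medialPoint_cSrc_ne_zero h₀ hout.2 hp hout.1

/-- **Locality.** The entries of an interface loop inside `γ` (mesh `δ`) are local edges of `γ`. -/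
theorem mem_localEdges_of_inside (hδ : δ ≠ 0) (h' : IsInterfaceLoop ω γ')
    (hsub : {z | (loopCurve δ 0 γ').wind z ≠ 0} ⊆ {z | (loopCurve δ 0 γ).wind z ≠ 0})
    {e : MedialVertex} (he : e ∈ γ') :
    e ∈ {e | e ∈ γ} ∪ cSrc '' {p : Site 2 × Fin 4 | (loopCurve 1 0 γ).wind (meshPoint 1 p.1) ≠ 0 ∨
      (loopCurve 1 0 γ).wind (faceCenter (cFace p)) ≠ 0} := by
  have hsub1 := setOf_wind_subset_of_mesh hδ hsub
  obtain ⟨p, rfl, hcell⟩ := exists_eq_cSrc_of_mem h' he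
  refine Or.inr ⟨p, ?_, rfl⟩
  rcases hcell with hv | hf
  · exact Or.inl (hsub1 (show (loopCurve 1 0 γ').wind (meshPoint 1 p.1) ≠ 0 from hv))
  · exact Or.inr (hsub1 (show (loopCurve 1 0 γ').wind (faceCenter (cFace p)) ≠ 0 from hf))

/-- Two configurations agreeing on the local edges of `γ` agree on the state of every entry of a
loop inside `γ`. -/
theorem isInterfaceLoop_inside_of_inter_eq (hδ : δ ≠ 0)
    (hωω' : ω ∩ ({e | e ∈ γ} ∪ cSrc '' {p : Site 2 × Fin 4 |
        (loopCurve 1 0 γ).wind (meshPoint 1 p.1) ≠ 0 ∨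
          (loopCurve 1 0 γ).wind (faceCenter (cFace p)) ≠ 0}) =
      ω' ∩ ({e | e ∈ γ} ∪ cSrc '' {p : Site 2 × Fin 4 |
        (loopCurve 1 0 γ).wind (meshPoint 1 p.1) ≠ 0 ∨
          (loopCurve 1 0 γ).wind (faceCenter (cFace p)) ≠ 0}))
    (h' : IsInterfaceLoop ω γ')
    (hsub : {z | (loopCurve δ 0 γ').wind z ≠ 0} ⊆ {z | (loopCurve δ 0 γ).wind z ≠ 0}) :
    IsInterfaceLoop ω' γ' := by
  refine isInterfaceLoop_of_forall_mem_iff (fun e he ↦ ?_) h'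
  have heF := mem_localEdges_of_inside hδ h' hsub he
  have key := congrArg (e ∈ ·) hωω'
  simp only [mem_inter_iff, heF, and_true, eq_iff_iff] at key
  exact key

/-- **Cylinder structure of the inside loops**: configurations agreeing on the local edges of `γ`
have the same loops inside `γ`. -/
theorem insideLoopsZ2_subset_of_inter_eq (hδ : δ ≠ 0)
    (hωω' : ω ∩ ({e | e ∈ γ} ∪ cSrc '' {p : Site 2 × Fin 4 |
        (loopCurve 1 0 γ).wind (meshPoint 1 p.1) ≠ 0 ∨
          (loopCurve 1 0 γ).wind (faceCenter (cFace p)) ≠ 0}) =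
      ω' ∩ ({e | e ∈ γ} ∪ cSrc '' {p : Site 2 × Fin 4 |
        (loopCurve 1 0 γ).wind (meshPoint 1 p.1) ≠ 0 ∨
          (loopCurve 1 0 γ).wind (faceCenter (cFace p)) ≠ 0})) :
    insideLoopsZ2 δ γ ω ⊆ insideLoopsZ2 δ γ ω' := by
  rintro u ⟨hu, hsub⟩
  refine ⟨?_, hsub⟩
  rcases hu with hu | hu <;> obtain ⟨γ', h', ht, rfl⟩ := hu
  · exact Or.inl ⟨γ', isInterfaceLoop_inside_of_inter_eq hδ hωω' h' hsub, ht, rfl⟩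
  · exact Or.inr ⟨γ', isInterfaceLoop_inside_of_inter_eq hδ hωω' h' hsub, ht, rfl⟩

/-- The cylinder property for `γ` itself over the local edges. -/
theorem isInterfaceLoop_iff_of_inter_eq
    (hωω' : ω ∩ ({e | e ∈ γ} ∪ cSrc '' {p : Site 2 × Fin 4 |
        (loopCurve 1 0 γ).wind (meshPoint 1 p.1) ≠ 0 ∨
          (loopCurve 1 0 γ).wind (faceCenter (cFace p)) ≠ 0}) =
      ω' ∩ ({e | e ∈ γ} ∪ cSrc '' {p : Site 2 × Fin 4 |
        (loopCurve 1 0 γ).wind (meshPoint 1 p.1) ≠ 0 ∨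
          (loopCurve 1 0 γ).wind (faceCenter (cFace p)) ≠ 0})) :
    IsInterfaceLoop ω γ ↔ IsInterfaceLoop ω' γ := by
  refine isInterfaceLoop_iff_of_forall_mem_iff fun e he ↦ ?_
  have key := congrArg (e ∈ ·) hωω'
  have heF : e ∈ ({e | e ∈ γ} ∪ cSrc '' {p : Site 2 × Fin 4 |
      (loopCurve 1 0 γ).wind (meshPoint 1 p.1) ≠ 0 ∨
        (loopCurve 1 0 γ).wind (faceCenter (cFace p)) ≠ 0}) :=
    Or.inl he
  simp only [mem_inter_iff, heF, and_true, eq_iff_iff] at key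
  exact key

/-! ## Step 3: the factorisation -/

/-- **STUB 1 (`stub_oneGenerationZ2`): the one-generation factorisation on `ℤ²`** — the statement
`OneGenerationZ2` of the definitions module, verbatim (registered signature): for `δ > 0`, `f`
carried by the winding interior of the drawn circuit `γ` with `∫ f = 0`, and any event `B₀` of the
edges strictly outside `γ`, `E[A_f ; I_γ ∩ B] = M_γ(f) · P(I_γ ∩ B)`. -/
theorem stub_oneGenerationZ2 : ∀ (δ : ℝ) (γ : List MedialVertex) (f : ℂ → ℝ)
    (B₀ : Set (Set MedialVertex)), 0 < δ → (∀ z, f z ≠ 0 → (loopCurve δ 0 γ).wind z ≠ 0) →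
    ∫ z, f z = 0 → MeasurableSet {ω : BondConfig (Site 2) | ω ∩ outsideEdges γ ∈ B₀} →
    ∫ ω in {ω | IsInterfaceLoop ω γ} ∩ {ω | ω ∩ outsideEdges γ ∈ B₀},
      (bondLoopConfig δ 0 ω).nestingWeight f ∂P2 =
    condTransformZ2 δ γ f * (P2 ({ω | IsInterfaceLoop ω γ} ∩ {ω | ω ∩ outsideEdges γ ∈ B₀})).toReal := by
  intro δ γ f B₀ hδ hf hf0 hBm
  set I : Set (BondConfig (Site 2)) := {ω | IsInterfaceLoop ω γ} with hI
  set B : Set (BondConfig (Site 2)) := {ω | ω ∩ outsideEdges γ ∈ B₀} with hB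
  set N : BondConfig (Site 2) → ℝ := fun ω ↦ ∏ᶠ u ∈ insideLoopsZ2 δ γ ω, u.nestingFactor f with hN
  have hIm : MeasurableSet I := measurableSet_setOf.2 (measurable_isInterfaceLoop γ)
  -- degenerate case: `γ` is an interface loop of no configuration
  by_cases hex : ∃ ω₀, IsInterfaceLoop ω₀ γ
  swap
  · have hI0 : I = ∅ := eq_empty_of_forall_notMem fun ω hω ↦ hex ⟨ω, hω⟩
    simp [hI0]
  obtain ⟨ω₀, h₀⟩ := hex
  -- the local edges of `γ`
  set F : Set MedialVertex := {e | e ∈ γ} ∪ cSrc '' {p : Site 2 × Fin 4 |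
    (loopCurve 1 0 γ).wind (meshPoint 1 p.1) ≠ 0 ∨
      (loopCurve 1 0 γ).wind (faceCenter (cFace p)) ≠ 0} with hF
  have hFfin : F.Finite := finite_localEdges γ
  have hFout : Disjoint F (outsideEdges γ) := disjoint_localEdges_outsideEdges h₀
  -- Step 2: `1_I · N` is determined by the coordinates in `F`, `B` by those outside `γ`
  have hΦ : ∀ ω ω' : BondConfig (Site 2), ω ∩ F = ω' ∩ F → I.indicator N ω = I.indicator N ω' := by
    intro ω ω' hωω'
    have hiff : IsInterfaceLoop ω γ ↔ IsInterfaceLoop ω' γ := isInterfaceLoop_iff_of_inter_eq hωω'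
    by_cases hω : ω ∈ I
    · rw [indicator_of_mem hω, indicator_of_mem (show ω' ∈ I from hiff.1 hω)]
      simp only [hN, Subset.antisymm (insideLoopsZ2_subset_of_inter_eq hδ.ne' hωω')
        (insideLoopsZ2_subset_of_inter_eq hδ.ne' hωω'.symm)]
    · rw [indicator_of_notMem hω, indicator_of_notMem (show ω' ∉ I from fun h ↦ hω (hiff.2 h))]
  have hIdet : DeterminedBy I F := by
    rw [determinedBy_iff]
    exact fun ω ω' h ↦ isInterfaceLoop_iff_of_inter_eq h
  have hBdet : DeterminedBy B (outsideEdges γ) := by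
    rw [determinedBy_iff]
    intro ω ω' h
    simp only [hB, mem_setOf_eq, h]
  -- Step 1, pointwise: `1_{I ∩ B} · A_f = (1_I · N) · 1_B`
  have hpt : (I ∩ B).indicator (fun ω ↦ (bondLoopConfig δ 0 ω).nestingWeight f) =
      fun ω ↦ I.indicator N ω * B.indicator 1 ω := by
    funext ω
    by_cases hωI : ω ∈ I
    · by_cases hωB : ω ∈ B
      · rw [indicator_of_mem (mem_inter hωI hωB), indicator_of_mem hωI, indicator_of_mem hωB,
          Pi.one_apply, mul_one]
        exact nestingWeight_eq_finprod_inside hδ hωI hf hf0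
      · rw [indicator_of_notMem fun h ↦ hωB h.2, indicator_of_notMem hωB, mul_zero]
    · rw [indicator_of_notMem fun h ↦ hωI h.1, indicator_of_notMem hωI, zero_mul]
  -- Step 3: product structure
  have hprod := bondPercolation_integral_mul_indicator (zdGraph 2) half F (outsideEdges γ)
    (I.indicator N) B hFfin hFout hΦ hBdet hBm
  have hinter := bondPercolation_inter_of_determinedBy (zdGraph 2) half hFfin hFout hIdet hBdet hBm
  have hLHS : ∫ ω in I ∩ B, (bondLoopConfig δ 0 ω).nestingWeight f ∂P2 =
      (∫ ω, I.indicator N ω ∂P2) * P2.real B := by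
    rw [← integral_indicator (hIm.inter hBm), hpt, hprod]
  have hcond : condTransformZ2 δ γ f = (∫ ω, I.indicator N ω ∂P2) / P2.real I := by
    rw [condTransformZ2, integral_indicator hIm, measureReal_def]
  have hIB : (P2 (I ∩ B)).toReal = P2.real I * P2.real B := by
    rw [measureReal_def, measureReal_def, ← ENNReal.toReal_mul]
    exact congrArg ENNReal.toReal hinter
  rw [hLHS, hcond, hIB]
  by_cases hI0 : P2.real I = 0
  · have hint : ∫ ω, I.indicator N ω ∂P2 = 0 := by
      rw [integral_indicator hIm]
      exact setIntegral_measure_zero _ ((measureReal_eq_zero_iff (measure_ne_top P2 I)).1 hI0)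
    simp [hint]
  · field_simp

/-- STUB 1 by name: `OneGenerationZ2` holds (the registered theorem `stub_oneGenerationZ2` is its
unfolding). -/
theorem oneGenerationZ2_of_stub : OneGenerationZ2 := stub_oneGenerationZ2

end Summit.CriticalPhenomena.CardyFormulaZ2.Cruxes.NestingRigidity.MarkovCascadeOneGeneration

end
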